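import Literature.AlgebraicGeometry.Morphisms.SectionConormalChart
import Mathlib.AlgebraicGeometry.Pullbacks
import Mathlib.CategoryTheory.Monoidal.Grp
import HarnessLib

/-!
# Functoriality of the conormal module of a section along a morphism of `R`-schemes; the cotangent
# map along the unit section of a homomorphism of group schemes over `Spec R`

Topic `Literature/AlgebraicGeometry/Morphisms`, namespace `Literature.AlgebraicGeometry.Morphisms`. DEFINITIONS with
bodies (`pullbackAlgHom`, `sectionConormalHom`, `unitSectionConormalHom`) and THEOREMS; no named fact, no `instance`, no
notation (net debt 0). Sequel of `Morphisms/SectionConormalChart`, whose §3 (`restrictAlgHom`, `sectionConormalEndo`)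
is the case `X = Y`, `u` an endomorphism, of this file.

THE PRINT. Görtz–Wedhorn, *Algebraic Geometry II*, (17.3) and Remark 17.14: for a commutative square of immersions
`i : Z → X`, `i' : Z' → X'` with `u : X' → X`, `Z' → Z`, there is a canonical map of conormal sheaves
`w_{i',i} : (u|_{Z'})^* 𝒞_i → 𝒞_{i'}`, functorial in the square. Here the immersions are SECTIONS `e_X`, `e_Y` of two
`R`-schemes `f_X : X → Spec R`, `f_Y : Y → Spec R` and the square is an `R`-morphism `u : X → Y` with `u ∘ e_X = e_Y`
(so `Z = Z' = Spec R`, `u|_{Z'} = id`): on affine charts `W_X ∋ e_X`, `W_Y ∋ e_Y` and a basic open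
`D(h) ⊆ W_X ∩ u⁻¹ W_Y` containing the section (`e_X^♯ h = 1`, which exists: `exists_sectionAug_eq_one_and_basicOpen_le_preimage`),
`w` is `I_Y/I_Y² —u^♯→ I_{X,h}/I_{X,h}² ≅ I_X/I_X²` (`Ideal.mapCotangent` of `u^♯ : Γ(Y, W_Y) → Γ(X, D(h))` followed by the
inverse of the localisation isomorphism `augCotangentLocalizationEquiv` of `RingTheory/Smooth`). For GROUP SCHEMES
`𝒢 → Spec R` (group objects of `Over (Spec R)`, as in the tree's `IsNeronModel`, `AbelianSchemes.AbelianScheme`) the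
section is the unit `η` and the conormal module `I/I² = ω_{𝒢/R} = Cot(𝒢/R)` is "the cotangent space of `𝒢/R` along the
zero-section" (Mazur 1978, §1 p. 137; SGA 3 II / Demazure–Gabriel II §4: `ω_{G/S} = e^* Ω¹_{G/S}`); a homomorphism
`φ : 𝒢 → 𝒢'` preserves the unit (Mathlib `IsMonHom.one_hom`) and so induces `Cot(φ) : Cot(𝒢'/R) → Cot(𝒢/R)` — the map
through which Mazur's Cor. 1.1 ("`0 → Cot(C/𝒪) → Cot(B/𝒪) → Cot(A/𝒪) → 0`" for Néron models) and Raynaud's Thm. A.1 are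
stated. This file supplies that map in the tree's chart language; it is brick (X2) of the NEEDS-X list of
`Literature/NumberTheory/EllipticCurves/ModularJacobianNeronDifferentials.lean` (the Manin-constant typer programme).

WHAT IS HERE (`f_X : X ⟶ Spec R`, `f_Y : Y ⟶ Spec R`, sections `e_X`, `e_Y`, opens `W_X` (`e_X⁻¹ W_X = ⊤`),
`W_Y` (`e_Y⁻¹ W_Y = ⊤`), `u : X ⟶ Y` with `u ≫ f_Y = f_X`, `e_X ≫ u = e_Y`, `h : Γ(X, W_X)` with `D(h) ⊆ u⁻¹ W_Y`):
* §1 `pullbackAlgHom` — `u^♯ : Γ(Y, W_Y) → Γ(X, D(h))` as an `R`-algebra map; `sectionAug_pullbackAlgHom` — it is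
  compatible with the augmentations (`e_X^♯ ∘ u^♯ = e_Y^♯`, because `u ∘ e_X = e_Y`); `augIdeal_le_comap_pullbackAlgHom`.
* §2 **`sectionConormalHom`** `: I_Y/I_Y² →ₗ[R] I_X/I_X²` (for `W_X` affine and `e_X^♯ h = 1`), its defining property
  `augCotangentLocalizationEquiv_sectionConormalHom`, the existence of a suitable `h`
  (`exists_sectionAug_eq_one_and_basicOpen_le_preimage`), and `sectionConormalHom_eq_sectionConormalEndo` (the case
  `X = Y` is the tree's `sectionConormalEndo`, by `rfl`).
* §3 group objects of `Over (Spec R)`: `unit_left_comp_hom` (`η.left` is a section of `𝒢.hom`),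
  `unit_left_comp_left` (a homomorphism preserves the unit section), **`unitSectionConormalHom`** — `Cot(φ)` for a
  homomorphism `φ : 𝒢 ⟶ 𝒢'` of group objects over `Spec R`, on unit-section charts.
NOT HERE: independence of the chart `(W, h)` (Görtz–Wedhorn II (17.3): `𝒞_e` «does not depend on the choice»), the
composition law `Cot(ψ ∘ φ) = Cot(φ) ∘ Cot(ψ)` (three charts), base change (Remark 17.15 (1)), and anything about Néron
models (the exactness statements of Mazur Cor. 1.1 / BLR 7.5/4 / Raynaud are the business of a sequel).

## References
* [GortzWedhorn2023] U. Görtz, T. Wedhorn, *Algebraic Geometry II* (2023), (17.3) (17.3.1), Remark 17.14.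
* [Mazur1978] B. Mazur, *Rational isogenies of prime degree*, Invent. Math. 44 (1978), §1 p. 137 (`Tan(G/S)`, `Cot(G/S)`
  along the zero-section), Cor. 1.1.
* [BoschLutkebohmertRaynaud1990] S. Bosch, W. Lütkebohmert, M. Raynaud, *Néron Models* (1990), §4.2 (invariant
  differentials `ω_{G/S}`), 7.5/4.
-/

noncomputable section

-- `TopCat.Presheaf` is not reducible (as in `Morphisms/SectionConormalChart`).
set_option backward.isDefEq.respectTransparency false

open CategoryTheory AlgebraicGeometry TopologicalSpace Opposite
open Literature.RingTheory.Smooth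

universe u

namespace Literature.AlgebraicGeometry.Morphisms

open ChartRing

/-! ### Applied forms of Mathlib's `appLE` lemmas (as in `SectionConormalChart`) -/

section AppLE

variable {X' Y Z : Scheme.{u}}

/-- `f^♯_{V ≤ W} (g^♯_{U ≤ V} x) = (f ≫ g)^♯_{U ≤ W} x` (Mathlib `Scheme.Hom.appLE_comp_appLE`, applied). [folklore] -/
private theorem appLE_appLE_apply (f : X' ⟶ Y) (g : Y ⟶ Z) (U : Z.Opens) (V : Y.Opens) (W : X'.Opens)
    (e₁ : V ≤ g ⁻¹ᵁ U) (e₂ : W ≤ f ⁻¹ᵁ V) (x : Γ(Z, U)) :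
    f.appLE V W e₂ (g.appLE U V e₁ x) = (f ≫ g).appLE U W (e₂.trans ((Opens.map f.base).map (homOfLE e₁)).le) x := by
  have := congrArg (fun φ => φ.hom x) (Scheme.Hom.appLE_comp_appLE f g U V W e₁ e₂)
  simpa only [CommRingCat.hom_comp, RingHom.comp_apply] using this

/-- `appLE` along equal morphisms. [folklore] -/
private theorem appLE_congr_hom {g g' : Y ⟶ Z} (hg : g = g') (U : Z.Opens) (V : Y.Opens)
    (hUV : V ≤ g ⁻¹ᵁ U) : g.appLE U V hUV = g'.appLE U V (hg ▸ hUV) := by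
  subst hg; rfl

end AppLE

section Hom

variable {R : Type u} [CommRing R] {X Y : Scheme.{u}} (fX : X ⟶ Spec (.of R)) (fY : Y ⟶ Spec (.of R))
  (eX : Spec (.of R) ⟶ X) (heX : eX ≫ fX = 𝟙 _) (eY : Spec (.of R) ⟶ Y) (heY : eY ≫ fY = 𝟙 _)
  {WX : X.Opens} (heWX : eX ⁻¹ᵁ WX = ⊤) {WY : Y.Opens} (heWY : eY ⁻¹ᵁ WY = ⊤)
  (u : X ⟶ Y) (hu : u ≫ fY = fX) (heu : eX ≫ u = eY)
  (h : ChartRing fX WX) (hhu : X.basicOpen (val h) ≤ u ⁻¹ᵁ WY)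

/-! ## §1 `u^♯ : Γ(Y, W_Y) → Γ(X, D(h))` and its compatibility with the augmentations -/

/-- **`u^♯ : Γ(Y, W_Y) → Γ(X, D(h))`** for an `R`-morphism `u : X → Y` (`u ≫ f_Y = f_X`) and a basic open
`D(h) ⊆ u⁻¹ W_Y` of a chart `W_X` of `X`, as an `R`-algebra map (the endomorphism case is the tree's
`restrictAlgHom`). [cite: GortzWedhorn2023, Remark 17.14] -/
def pullbackAlgHom : ChartRing fY WY →ₐ[R] ChartRing fX (X.basicOpen (val h)) where
  toRingHom := (mk fX (X.basicOpen (val h))).comp ((u.appLE WY (X.basicOpen (val h)) hhu).hom.comp val)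
  commutes' r := val_injective fX _ (by
    change u.appLE WY (X.basicOpen (val h)) hhu (val (algebraMap R (ChartRing fY WY) r)) =
      val (algebraMap R (ChartRing fX (X.basicOpen (val h))) r)
    rw [val_algebraMap, val_algebraMap, appLE_appLE_apply, appLE_congr_hom hu])

/-- Unfolding of `pullbackAlgHom`. [cite: GortzWedhorn2023, Remark 17.14] -/
theorem val_pullbackAlgHom (s : ChartRing fY WY) :
    val (pullbackAlgHom fX fY u hu h hhu s) = u.appLE WY (X.basicOpen (val h)) hhu (val s) :=
  rfl

/-- The endomorphism case: for `X = Y`, `f_X = f_Y`, `pullbackAlgHom` is the tree's `restrictAlgHom`.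
[cite: GortzWedhorn2023, Remark 17.14] -/
theorem pullbackAlgHom_eq_restrictAlgHom (v : X ⟶ X) (hv : v ≫ fX = fX) (hhv : X.basicOpen (val h) ≤ v ⁻¹ᵁ WX) :
    pullbackAlgHom fX fX v hv h hhv = restrictAlgHom fX v hv h hhv :=
  rfl

include heu in
/-- **`u ∘ e_X = e_Y` ⇒ `u^♯` is compatible with the augmentations**: `e_X^♯_{D(h)} ∘ u^♯ = e_Y^♯_{W_Y}`.
[cite: GortzWedhorn2023, Remark 17.14] -/
theorem sectionAug_pullbackAlgHom (hh : sectionAug fX eX heX heWX h = 1) (s : ChartRing fY WY) :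
    sectionAug fX eX heX (preimage_basicOpen_eq_top fX eX heX heWX h hh) (pullbackAlgHom fX fY u hu h hhu s) =
      sectionAug fY eY heY heWY s := by
  rw [sectionAug_apply, sectionAug_apply, val_pullbackAlgHom, appLE_appLE_apply, appLE_congr_hom heu]

include heu in
/-- `u^♯` maps the augmentation ideal of `W_Y` into that of `D(h)`. [cite: GortzWedhorn2023, Remark 17.14] -/
theorem augIdeal_le_comap_pullbackAlgHom (hh : sectionAug fX eX heX heWX h = 1) :
    augIdeal (sectionAug fY eY heY heWY) ≤
      (augIdeal (sectionAug fX eX heX (preimage_basicOpen_eq_top fX eX heX heWX h hh))).comap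
        (pullbackAlgHom fX fY u hu h hhu) := by
  intro s hs
  rw [Ideal.mem_comap, mem_augIdeal_iff, sectionAug_pullbackAlgHom fX fY eX heX eY heY heWX heWY u hu heu h hhu hh]
  exact (mem_augIdeal_iff _ s).1 hs

/-! ## §2 The map of conormal modules `w : I_Y/I_Y² → I_X/I_X²` -/

/-- **The map of conormal modules of the sections along `u`** (`u : X → Y` over `Spec R` with `u ∘ e_X = e_Y`;
`W_X` an affine chart of `e_X`, `W_Y` a chart of `e_Y`, `D(h) ⊆ W_X ∩ u⁻¹ W_Y` a basic open containing the
section): the composite `I_Y/I_Y² —u^♯→ I_{X,h}/I_{X,h}² ≅ I_X/I_X²` of `Ideal.mapCotangent u^♯` with the inverse of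
the localisation isomorphism `augCotangentLocalizationEquiv` — Görtz–Wedhorn's `w_{i',i}` for the square
`e_Y = u ∘ e_X`, read on the charts. For group schemes and `u` a homomorphism this is `Cot(u) : Cot(Y/R) → Cot(X/R)`
along the zero-sections (§3). [cite: GortzWedhorn2023, Remark 17.14 and (17.3)] [cite: Mazur1978, §1 (p. 137)] -/
def sectionConormalHom (hWX : IsAffineOpen WX) (hh : sectionAug fX eX heX heWX h = 1) :
    (augIdeal (sectionAug fY eY heY heWY)).Cotangent →ₗ[R] (augIdeal (sectionAug fX eX heX heWX)).Cotangent :=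
  haveI := ChartRing.isLocalization_away fX hWX h
  (augCotangentLocalizationEquiv (sectionAug fX eX heX heWX)
      (sectionAug fX eX heX (preimage_basicOpen_eq_top fX eX heX heWX h hh))
      (sectionAug_algebraMap fX eX heX heWX h hh) h hh).symm.toLinearMap ∘ₗ
    (augIdeal (sectionAug fY eY heY heWY)).mapCotangent _ (pullbackAlgHom fX fY u hu h hhu)
      (augIdeal_le_comap_pullbackAlgHom fX fY eX heX eY heY heWX heWY u hu heu h hhu hh)

/-- **Defining property of `sectionConormalHom`**: followed by the localisation isomorphism `I_X/I_X² ≅ I_{X,h}/I_{X,h}²`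
it is `Ideal.mapCotangent u^♯`; on classes, `[s] ↦ w [s]` with `[w s]_h = [u^♯ s]_h`. [cite: GortzWedhorn2023, Remark 17.14] -/
theorem augCotangentLocalizationEquiv_sectionConormalHom (hWX : IsAffineOpen WX) (hh : sectionAug fX eX heX heWX h = 1)
    (x : (augIdeal (sectionAug fY eY heY heWY)).Cotangent) :
    haveI := ChartRing.isLocalization_away fX hWX h
    augCotangentLocalizationEquiv (sectionAug fX eX heX heWX)
        (sectionAug fX eX heX (preimage_basicOpen_eq_top fX eX heX heWX h hh))
        (sectionAug_algebraMap fX eX heX heWX h hh) h hh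
        (sectionConormalHom fX fY eX heX eY heY heWX heWY u hu heu h hhu hWX hh x) =
      (augIdeal (sectionAug fY eY heY heWY)).mapCotangent _ (pullbackAlgHom fX fY u hu h hhu)
        (augIdeal_le_comap_pullbackAlgHom fX fY eX heX eY heY heWX heWY u hu heu h hhu hh) x := by
  rw [sectionConormalHom, LinearMap.comp_apply, LinearEquiv.coe_toLinearMap, LinearEquiv.apply_symm_apply]

/-- The endomorphism case: for `X = Y`, `f_X = f_Y`, `e_X = e_Y`, `W_X = W_Y`, `sectionConormalHom` is the tree's
`sectionConormalEndo` (definitionally). [cite: GortzWedhorn2023, Remark 17.14] -/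
theorem sectionConormalHom_eq_sectionConormalEndo (v : X ⟶ X) (hv : v ≫ fX = fX) (hev : eX ≫ v = eX)
    (hhv : X.basicOpen (val h) ≤ v ⁻¹ᵁ WX) (hWX : IsAffineOpen WX) (hh : sectionAug fX eX heX heWX h = 1) :
    sectionConormalHom fX fX eX heX eX heX heWX heWX v hv hev h hhv hWX hh =
      sectionConormalEndo fX eX heX heWX v hv hev h hhv hWX hh :=
  rfl

include heu heWY in
/-- **A basic open through which `u^♯` can be read exists**: for `W_X` affine there is `h ∈ Γ(X, W_X)` with
`e_X^♯ h = 1` and `D(h) ⊆ u⁻¹ W_Y` (the open `u⁻¹ W_Y` contains the section since `u ∘ e_X = e_Y` and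
`e_Y⁻¹ W_Y = ⊤`; then `exists_sectionAug_eq_one_and_basicOpen_le`). [cite: GortzWedhorn2023, (17.3)] -/
theorem exists_sectionAug_eq_one_and_basicOpen_le_preimage (hWX : IsAffineOpen WX) :
    ∃ h : ChartRing fX WX, sectionAug fX eX heX heWX h = 1 ∧ X.basicOpen (val h) ≤ u ⁻¹ᵁ WY := by
  refine exists_sectionAug_eq_one_and_basicOpen_le fX eX heX heWX hWX (u ⁻¹ᵁ WY) ?_
  change (eX ≫ u) ⁻¹ᵁ WY = ⊤
  rw [heu, heWY]

end Hom

/-! ## §3 Group objects of `Over (Spec R)`: the cotangent map along the unit section of a homomorphism -/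

section GroupObject

open MonObj

variable {R : Type u} [CommRing R] (𝒢 𝒢' : Over (Spec (.of R))) [GrpObj 𝒢] [GrpObj 𝒢']

/-- The unit `η.left : Spec R → 𝒢` of a group object of `Over (Spec R)` is a section of the structure morphism
(`Over.w`; as in `AbelianSchemes.AbelianScheme.unit_left_comp_hom`). [cite: Mazur1978, §1 (p. 137)] -/
theorem unit_left_comp_hom : η[𝒢].left ≫ 𝒢.hom = 𝟙 _ :=
  Over.w η[𝒢]

variable {𝒢 𝒢'} in
/-- **A homomorphism of group objects over `Spec R` preserves the unit section**: `η_𝒢 ≫ φ = η_{𝒢'}` on underlying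
schemes (Mathlib `IsMonHom.one_hom`, read in `Over`). [cite: Mazur1978, §1 (p. 137)] -/
theorem unit_left_comp_left (φ : 𝒢 ⟶ 𝒢') [IsMonHom φ] : η[𝒢].left ≫ φ.left = η[𝒢'].left := by
  rw [← Over.comp_left, IsMonHom.one_hom]

variable {𝒢 𝒢'} in
/-- **`Cot(φ) : Cot(𝒢'/R) → Cot(𝒢/R)`, the cotangent map along the zero-sections of a homomorphism `φ : 𝒢 → 𝒢'` of
group schemes over `Spec R`** (group objects of `Over (Spec R)`, e.g. Néron models `IsNeronModel`, abelian schemes),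
read on unit-section charts `W ⊆ 𝒢` (affine, `η⁻¹ W = ⊤`), `W' ⊆ 𝒢'` (`η⁻¹ W' = ⊤`) through a basic open
`D(h) ⊆ W ∩ φ⁻¹ W'` with `η^♯ h = 1` (which exists, `exists_sectionAug_eq_one_and_basicOpen_le_preimage`):
`sectionConormalHom` for the square `η_{𝒢'} = φ ∘ η_𝒢`. `Cot(𝒢/R) = I/I² = ω_{𝒢/R}` is the cotangent space along the
zero-section of Mazur 1978 §1 / the module of invariant differentials of BLR §4.2; `Cot(φ)` is the map in Mazur's
Cor. 1.1. [cite: Mazur1978, §1 (p. 137) and Cor. 1.1] [cite: GortzWedhorn2023, Remark 17.14] -/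
def unitSectionConormalHom (φ : 𝒢 ⟶ 𝒢') [IsMonHom φ] {W : 𝒢.left.Opens} (hW : IsAffineOpen W)
    (hηW : η[𝒢].left ⁻¹ᵁ W = ⊤) {W' : 𝒢'.left.Opens} (hηW' : η[𝒢'].left ⁻¹ᵁ W' = ⊤) (h : ChartRing 𝒢.hom W)
    (hh : sectionAug 𝒢.hom η[𝒢].left (unit_left_comp_hom 𝒢) hηW h = 1)
    (hhφ : 𝒢.left.basicOpen (val h) ≤ φ.left ⁻¹ᵁ W') :
    (augIdeal (sectionAug 𝒢'.hom η[𝒢'].left (unit_left_comp_hom 𝒢') hηW')).Cotangent →ₗ[R]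
      (augIdeal (sectionAug 𝒢.hom η[𝒢].left (unit_left_comp_hom 𝒢) hηW)).Cotangent :=
  sectionConormalHom 𝒢.hom 𝒢'.hom η[𝒢].left (unit_left_comp_hom 𝒢) η[𝒢'].left (unit_left_comp_hom 𝒢') hηW hηW'
    φ.left (Over.w φ) (unit_left_comp_left φ) h hhφ hW hh

variable {𝒢 𝒢'} in
/-- For a homomorphism `φ : 𝒢 → 𝒢'` and unit-section charts `W` (affine), `W'`, a basic open `D(h) ⊆ W ∩ φ⁻¹ W'` with
`η^♯ h = 1` exists, so that `unitSectionConormalHom φ …` is available. [cite: GortzWedhorn2023, (17.3)] -/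
theorem exists_unitSection_basicOpen_le_preimage (φ : 𝒢 ⟶ 𝒢') [IsMonHom φ] {W : 𝒢.left.Opens}
    (hW : IsAffineOpen W) (hηW : η[𝒢].left ⁻¹ᵁ W = ⊤) {W' : 𝒢'.left.Opens} (hηW' : η[𝒢'].left ⁻¹ᵁ W' = ⊤) :
    ∃ h : ChartRing 𝒢.hom W, sectionAug 𝒢.hom η[𝒢].left (unit_left_comp_hom 𝒢) hηW h = 1 ∧
      𝒢.left.basicOpen (val h) ≤ φ.left ⁻¹ᵁ W' :=
  exists_sectionAug_eq_one_and_basicOpen_le_preimage 𝒢.hom η[𝒢].left (unit_left_comp_hom 𝒢) η[𝒢'].left hηW hηW'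
    φ.left (unit_left_comp_left φ) hW

end GroupObject

end Literature.AlgebraicGeometry.Morphisms

end
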